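import Literature.AlgebraicGeometry.HodgeTheory.SmallChowGroupsHodgeConjectureHolds
import Literature.AlgebraicGeometry.Motives.CompleteIntersectionChowGroups
import Literature.AlgebraicGeometry.Motives.Sweep1
import Mathlib.Algebra.CharP.Algebra
import HarnessLib

/-!
# The Hodge conjecture for ALL smooth cubic eightfolds from their small Chow groups (Laterveer / Vial 2013 Thm. 7.1 (i) with Otwinowska 1999 / Hirschowitz–Iyer 2010) — proved assembly

Family `hodge`, layer `Literature/AlgebraicGeometry/HodgeTheory`. PROVED glue, no new fact (D-0026):
the sibling of `CubicFourfoldHodgeConjectureProofs` ("route 2: through small Chow groups") one rung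
up the hypersurface ladder. For a smooth projective complex eightfold `X`, Vial 2013 Thm. 7.1 (i)
(Laterveer 1998) — a THEOREM of the tree, `Vial2013_hodgeConjectureFor_of_chowGroups_rank_le_one_holds`
— gives `HodgeConjectureFor 8 X` as soon as `CH_i(X_L) ⊗ ℚ` has rank `≤ 1` for `i ≤ ⌊(8−4)/2⌋ = 2` and
every algebraically closed `L ⊇ ℂ`. For a smooth cubic eightfold these ranks are `≤ 1`:
`CH₀`, `CH₁` by Esnault–Levine–Viehweg 1997 Thm. 4.6 (`l = 1`: `C(4,2) = 6 ≤ 9`; typed fact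
`Motives.EsnaultLevineViehweg1997_chowGroup_rank_le_one`), `CH₂` by Otwinowska 1999 = Hirschowitz–Iyer
2010 Thm. 1.5 at `(n, r, s, d) = (9, 2, 1, (3))` (typed fact
`Motives.HirschowitzIyer2010_chowTwo_rank_le_one_cubicEightfold`; Vial 2013 §7.2.2: "`CH₂(X) = ℚ` for
`dim X ≥ 8` … improved to `dim X = 8` by Otwinowska"). Vial 2013 §7.2.2 draws exactly this kind of
consequence (Prop. 7.5: cubic sevenfolds fibred over curves are Kimura finite-dimensional, smooth
such satisfy Murre's conjectures) and Thm. 7.1 (i) is stated for every `d`; the cubic-eightfold Hodge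
corollary is PRINT-IMPLIED (Thm. 7.1 (i) ∘ §7.2.2), not printed as a sentence — hence assembled here as a
theorem from the two typed Chow facts, never vendored as a fact of its own.

WHAT IS AN EXPLICIT HYPOTHESIS (as in the fourfold sibling
`hodgeTwoTwo_algebraic_cubicFourfold_of_vial2013_of_esnaultLevineViehweg`): the bridge "the base change
`X_L` of the smooth cubic eightfold `X` to an algebraically closed `L ⊇ ℂ` is a smooth complete
intersection of multidegree `(3)` in `ℙ⁹_L`" (`Motives.IsSmoothCompleteIntersection 8 ![3] (X_L)`: the
converse Jacobian criterion for `V₊(F)` and base change of the embedding; routine, absent from the tree),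
and the Chow input `hCH` itself, in the shape "for every smooth complete intersection `Y` of multidegree
`(3)` in `ℙ⁹_k`, `k` algebraically closed of characteristic `0`, and every `i ≤ 2`, any two classes in
`CH_i(Y)` are `ℤ`-linearly dependent" — which is the statement of the tree's theorem
`Motives.chowGroup_rank_le_one_of_le_two_cubicEightfold h hR` (file `Motives/CubicEightfoldChowTwo`)
granted the two named facts `h := Motives.HirschowitzIyer2010_chowTwo_rank_le_one_cubicEightfold`
(`CH₂`) and `hR := Motives.EsnaultLevineViehweg1997_chowGroup_rank_le_one` (`CH₀, CH₁`), both at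
universe `0`: consumers write `hodgeConjectureFor_cubicEightfold_of_chow (fun _ _ _ _ _ hY _ hi x y ↦
Motives.chowGroup_rank_le_one_of_le_two_cubicEightfold h hR hY hi x y)`. (The input is kept as a
hypothesis of this shape, rather than as the two facts, so that any other proof of the Chow statement —
e.g. a future discharge through the tree's Hirschowitz–Iyer machinery `Motives/HirschowitzIyer*` — feeds
the same theorem.) Nothing here is specific to the
GENERIC cubic eightfold: contrast `Terasoma1990_hodgeFourFour_algebraic_cubicEightfold` (hypothesis: the
fourfold of `3`-planes is smooth) and the retired route `ConiveauLadderCubicEightfolds` (which sought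
`CH₂` only generically, via Bai 2024 ∘ Mboro 2018, plus a specialisation transfer) — Hirschowitz–Iyer's
Thm. 1.5 "concerns all hypersurfaces, not only smooth ones" (§1.7), so no transfer is needed.

## References

* [Vial2013] Ch. Vial, Algebraic cycles and fibrations, Doc. Math. 18 (2013), Thm. 7.1 (i), §7.2.2, Prop. 7.5.
* [Laterveer1998] R. Laterveer, Algebraic varieties with small Chow groups, J. Math. Kyoto Univ. 38 (1998).
* [HirschowitzIyer2010] A. Hirschowitz, J. N. N. Iyer, Contemp. Math. 522 (2010), Thm. 1.5, Prop. 1.4, §1.7.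
* [Otwinowska1999] A. Otwinowska, C. R. Acad. Sci. Paris 329 (1999) 51–56.
* [EsnaultLevineViehweg1997] H. Esnault, M. Levine, E. Viehweg, Duke Math. J. 87 (1997), Thm. 4.6.
* [Terasoma1990] T. Terasoma, Hodge conjecture for cubic 8-folds, Math. Ann. 288 (1990) (generic case).
-/

noncomputable section

namespace Literature.AlgebraicGeometry.HodgeTheory

section HodgeTheory

/-- **HC for an eightfold all of whose algebraically closed base changes are smooth cubic eightfolds,
granted the Chow input.** For a smooth projective complex eightfold `X` such that `X_L ⊂ ℙ⁹_L` is a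
smooth complete intersection of multidegree `(3)` for every algebraically closed `L ⊇ ℂ` (`L` is then of
characteristic `0`): `CH_i(X_L) ⊗ ℚ` has rank `≤ 1` for `i ≤ 2` by the Chow input `hCH` (the
statement of `Motives.chowGroup_rank_le_one_of_le_two_cubicEightfold`, at universe `0` as Vial's base
changes `X_L`, `L : Type`, require; an inline hypothesis, not a named fact), so Vial 2013 Thm. 7.1 (i)
(`d = 8`, `⌊(8−4)/2⌋ = 2`; the tree's theorem
`Vial2013_hodgeConjectureFor_of_chowGroups_rank_le_one_holds`) gives `HodgeConjectureFor 8 X`.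
[cite: Vial2013, Thm 7.1 (i) and §7.2.2] [cite: HirschowitzIyer2010, Thm. 1.5 at (9,2,1,(3))]
[cite: EsnaultLevineViehweg1997, Thm 4.6, first bullet] -/
theorem hodgeConjectureFor_eight_of_baseChange_cubicEightfold
    (hCH : ∀ ⦃k : Type⦄ [Field k] [IsAlgClosed k] [CharZero k] ⦃Y : Motives.SchemeOver k⦄,
      Motives.IsSmoothCompleteIntersection 8 ![3] Y → ∀ ⦃i : ℕ⦄, i ≤ 2 →
        ∀ x y : Motives.ChowGroup Y.left i, ∃ p q : ℤ, (p ≠ 0 ∨ q ≠ 0) ∧ p • x = q • y)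
    {X : Motives.SchemeOver ℂ} (hX : Motives.IsSmoothProjective 8 X)
    (hbc : ∀ (L : Type) [Field L] [IsAlgClosed L] [Algebra ℂ L],
      Motives.IsSmoothCompleteIntersection 8 ![3] ((Motives.baseChange ℂ L).obj X)) :
    HodgeConjectureFor 8 X := by
  refine Vial2013_hodgeConjectureFor_of_chowGroups_rank_le_one_holds hX fun L _ _ _ i hi a b ↦ ?_
  haveI : CharZero L := charZero_of_injective_algebraMap (algebraMap ℂ L).injective
  exact hCH (hbc L) (by omega) a b

/-- **The Hodge conjecture for EVERY smooth cubic eightfold `X ⊂ ℙ⁹_ℂ`** (`Motives.IsSmoothHypersurface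
8 3 X`, the spelling of `Terasoma1990/CubicEightfoldHodgeConjecture` and of the retired route
`ConiveauLadderCubicEightfolds`), granted: the Chow input `hCH` (provided by
`Motives.chowGroup_rank_le_one_of_le_two_cubicEightfold` from the two named facts), and the two routine
bridges — a smooth hypersurface of degree `3` is a smooth complete intersection of multidegree `![3]`
(Jacobian criterion, `hci`), and smooth complete intersections of multidegree `![3]` are stable under base
change to algebraically closed overfields (`hbc`). In every codimension `p`; for `2p ≠ 8` this is
Lefschetz, for `p = 4` it is new relative to Terasoma 1990 (generic `X` only).
[cite: Vial2013, Thm 7.1 (i) and §7.2.2] [cite: HirschowitzIyer2010, Thm. 1.5 at (9,2,1,(3)); §1.7]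
[cite: Otwinowska1999, Théorème] [cite: EsnaultLevineViehweg1997, Thm 4.6, first bullet] -/
theorem hodgeConjectureFor_cubicEightfold_of_chow
    (hCH : ∀ ⦃k : Type⦄ [Field k] [IsAlgClosed k] [CharZero k] ⦃Y : Motives.SchemeOver k⦄,
      Motives.IsSmoothCompleteIntersection 8 ![3] Y → ∀ ⦃i : ℕ⦄, i ≤ 2 →
        ∀ x y : Motives.ChowGroup Y.left i, ∃ p q : ℤ, (p ≠ 0 ∨ q ≠ 0) ∧ p • x = q • y)
    (hci : ∀ ⦃X : Motives.SchemeOver ℂ⦄, Motives.IsSmoothHypersurface 8 3 X →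
      Motives.IsSmoothCompleteIntersection 8 ![3] X)
    (hbc : ∀ ⦃X : Motives.SchemeOver ℂ⦄, Motives.IsSmoothCompleteIntersection 8 ![3] X →
      ∀ (L : Type) [Field L] [IsAlgClosed L] [Algebra ℂ L],
        Motives.IsSmoothCompleteIntersection 8 ![3] ((Motives.baseChange ℂ L).obj X))
    {X : Motives.SchemeOver ℂ} (hX : Motives.IsSmoothHypersurface 8 3 X) :
    HodgeConjectureFor 8 X :=
  hodgeConjectureFor_eight_of_baseChange_cubicEightfold hCH hX.1 (hbc (hci hX))

/-- The same for `X` presented as a smooth complete intersection of multidegree `(3)` in `ℙ⁹_ℂ`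
(`Motives.IsSmoothCompleteIntersection 8 ![3] X`, the spelling of the Chow facts), granted `hCH` and the
base-change bridge only. [cite: Vial2013, Thm 7.1 (i) and §7.2.2]
[cite: HirschowitzIyer2010, Thm. 1.5 at (9,2,1,(3))] -/
theorem hodgeConjectureFor_cubicEightfoldCI_of_chow
    (hCH : ∀ ⦃k : Type⦄ [Field k] [IsAlgClosed k] [CharZero k] ⦃Y : Motives.SchemeOver k⦄,
      Motives.IsSmoothCompleteIntersection 8 ![3] Y → ∀ ⦃i : ℕ⦄, i ≤ 2 →
        ∀ x y : Motives.ChowGroup Y.left i, ∃ p q : ℤ, (p ≠ 0 ∨ q ≠ 0) ∧ p • x = q • y)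
    (hbc : ∀ ⦃X : Motives.SchemeOver ℂ⦄, Motives.IsSmoothCompleteIntersection 8 ![3] X →
      ∀ (L : Type) [Field L] [IsAlgClosed L] [Algebra ℂ L],
        Motives.IsSmoothCompleteIntersection 8 ![3] ((Motives.baseChange ℂ L).obj X))
    {X : Motives.SchemeOver ℂ} (hX : Motives.IsSmoothCompleteIntersection 8 ![3] X) :
    HodgeConjectureFor 8 X :=
  hodgeConjectureFor_eight_of_baseChange_cubicEightfold hCH hX.1 (hbc hX)

/-- **The Chow input holds granted Esnault–Levine–Viehweg alone in the ranges ELV covers** — a check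
that the shape is the right one: for `i ≤ 1` it is exactly the typed ELV fact at `l = 1` (`3 ≥ 3`,
`C(1+3, 2) = 6 ≤ 8 + 1`); only `i = 2` needs Otwinowska / Hirschowitz–Iyer (ELV would need
`C(5,3) = 10 ≤ 9`, false). [cite: EsnaultLevineViehweg1997, Thm 4.6, first bullet] [cite: Vial2013, §7.2.2] -/
theorem cubicEightfold_chowGroup_rank_le_one_of_le_one
    (hR : Motives.EsnaultLevineViehweg1997_chowGroup_rank_le_one.{0})
    {k : Type} [Field k] [IsAlgClosed k] [CharZero k] {Y : Motives.SchemeOver k}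
    (hY : Motives.IsSmoothCompleteIntersection 8 ![3] Y) {i : ℕ} (hi : i ≤ 1)
    (x y : Motives.ChowGroup Y.left i) : ∃ p q : ℤ, (p ≠ 0 ∨ q ≠ 0) ∧ p • x = q • y :=
  hR hY (fun a ↦ by fin_cases a; simp) (l := 1) (Or.inl ⟨0, by simp⟩) (by simp [Nat.choose]) hi x y

/-- Upper bound (sanity): conversely the summit statement (HC for every smooth projective complex
variety, spelled with `HodgeConjectureFor`) contains the cubic-eightfold statement with all hypotheses
dropped, so nothing beyond an instance family of the summit is assembled here. [cite: Vial2013, Thm 7.1 (i)] -/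
theorem hodgeConjectureFor_cubicEightfold_of_hodgeConjectureFor
    (hHC : ∀ ⦃n : ℕ⦄ ⦃X : Motives.SchemeOver ℂ⦄, Motives.IsSmoothProjective n X → HodgeConjectureFor n X)
    {X : Motives.SchemeOver ℂ} (hX : Motives.IsSmoothHypersurface 8 3 X) : HodgeConjectureFor 8 X :=
  hHC hX.1

end HodgeTheory

end Literature.AlgebraicGeometry.HodgeTheory

end
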